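import Literature.NumberTheory.Automorphic.Liu2021.Def45RMuForm
import Literature.NumberTheory.Automorphic.Liu2021.Def45RMuExistsNonVacuity
import Literature.NumberTheory.Automorphic.Liu2021.Def45PolarisationNormalised
import HarnessLib

/-!
# [Liu 2021] Definition 4.5 (2), fourth bullet — SUPPLY of `Def45.RMuForm` at every face of a Galois CM field

Y. Liu, *Fourier–Jacobi cycles and arithmetic relative trace formula*, Camb. J. Math. **9** (2021) = arXiv:2102.11518
[Liu2021]; TeX source `FJcycle.tex` (md5 `6db49a74122d…`), §4.1, Definition 4.5 (2) fourth bullet (l. 1957) and the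
proof of Prop. 4.6 (1), l. 1982 «The existence of `r_μ` is obvious».  Sub-row (CP-S4c-P) r-half of the pub-hodgecm2
team table `HOME/pinning/HCMISOG-TABLE.md`; red-team WATCH W1, r-half.

Sequel of `Liu2021/Def45RMuForm` (the fourth bullet typed REAL on orbits of `H¹`: `Def45.IsRMuNormalisable`,
`Def45.RMuForm`) and of hcmisog-isog-2's ENGINE `Liu2021/Def45RMuExists` / `Def45RMuExistsNonVacuity` (`r_μ` exists for
every abstract de Rham datum `(H, e, B)` at every face of a Galois CM field — trace duality + «every Hermitian unit of
`E ⊗ M_μ` is a norm», `Def45RMuGalois`; general-algebra layer of record: pub-hodgecm2 b25's `CorCM/RMuNorm*`).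

## What this file proves (theorems only; no `def`, no named fact)

* §1 `Def45.isRMuNormalisable_of_isPolarisationClass` — **bullet 3 ⇒ bullet 4 (on every admissible orbit)**: for `F` a
  CM field GALOIS over `ℚ`, `μ` conjugate symplectic, `A/F`, `i : M_μ → End⁰(A)` and `θ₂` with `IsPolarisationClass
  (M_μ ⊆ ℂ) A i θ₂`, the predicate `IsRMuNormalisable (M_μ ⊆ ℂ) A i θ₂` HOLDS.  Proof: an admissible orbit
  `(w₀, c₀)` (pairing `F`-valued and perfect on `(F ⊗ M_μ) · w₀`) gives an `F`-bilinear form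
  `B(x, y) = σ⁻¹ c₀ Q_{θ₂}(x · w₀, y · w₀)` on `L = F ⊗_ℚ M_μ` itself; bullet 3 (the Rosati relation (c) of
  `IsPolarisationClass`, through `actL_mul` / `actL_one_tmul`) is the engine's adjunction hypothesis, alternation of
  `Q_{θ₂}` on `H¹` (`polarizationPairingOne_self`) its `IsAlt`, perfectness its `Nondegenerate`; the engine's unit form
  `exists_isUnit_forall₂_eq_trace_muAlgValueField` at `(H, e) := (L, id)` returns the unit `a` and the identity with
  `e = 1` (Liu's `c := c₀`).
* §2 `Def45.rMuForm_nonempty σ hμ : ∀ A i, Nonempty (RMuForm σ hμ A i)` — the carrier of `PolDR`'s `R`-shape is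
  INHABITED at every `(A, i)`: the END displays' `hR` becomes THIS THEOREM when `R := RMuForm σ hμ`.
* §2 `Def45.nonempty_cmDatum_polDR_rMuForm_of_casselman σ hμ hw h21` — [Liu2021] Prop. 4.6 (1) over
  `Carriers.ofPolDR μ (PolDR σ hμ (RMuForm σ hμ))` from the ONE cite `h21` ([Shimura1998] Thm. 21.4) and NOTHING ELSE:
  bullets 1–3 real (`Def45PolarisationNormalised.nonempty_cmDatum_polarised_of_casselman'`) and bullet 4 real-and-proved.
  Consumer recipe (pin-3's `…RestOne*` re-cuts): `P := Def45.PolDR ι₁ (isConjugateSymplectic_muOfInvType ι₁ Φ)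
  (Def45.RMuForm ι₁ (isConjugateSymplectic_muOfInvType ι₁ Φ))`,
  `hObj := Def45.nonempty_cmDatum_polDR_rMuForm_of_casselman ι₁ … h21` — the binders `R`, `hR` DISAPPEAR.

HONEST SCOPE.  The class of the reading is that of `Def45RMuForm` (READING P-R2: bullet 4 asked on EVERY admissible
`E ⊗ M_μ`-orbit of `H¹(A_ℂ(ℂ); ℂ)`, the de Rham `E`-structure being one by [Grothendieck 1966] + [Deligne 1982, §1]; ≥ print
as a restriction, = print at Galois faces since proved).  Nothing here constructs `H_1^{dR}(A_μ/E)`, Liu's `X_K`, `A_K`,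
`Ω(μ)`, or touches `hM`; no END display binder is discharged BY THIS FILE (a re-cut taking the recipe is the owners' and
the red team's call); HC_CM is NOT proved.  No named fact (D-0026 debt 0).

References: [Liu2021] Y. Liu, Camb. J. Math. 9 (2021) = arXiv:2102.11518 — §4.1 l. 1928, Def. 4.5 (2) (TeX ll. 1944–1958;
bullet 3 l. 1955, bullet 4 l. 1957), Prop. 4.6 (1) (l. 1969) and its proof (ll. 1975–1984, «obvious» l. 1982);
[Shimura1998] G. Shimura, *Abelian Varieties with Complex Multiplication and Modular Functions* (1998), §5.2, §6.2 Thm. 4,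
§21.4 Thm. 21.4; [Grothendieck1966deRham] Publ. Math. IHÉS 29 (1966) Thm. 1′; [Deligne1982HodgeCycles] LNM 900 (1982) §1.
-/

set_option autoImplicit false

noncomputable section

open scoped TensorProduct NumberField ComplexConjugate
open CategoryTheory NumberField
open Literature.AlgebraicGeometry.Motives Literature.AlgebraicGeometry.HodgeTheory
open Literature.AlgebraicGeometry.ComplexMultiplication
open Literature.NumberTheory.ComplexMultiplication
open Literature.NumberTheory.GaloisRepresentations
open Literature.AlgebraicTopology.SingularHomology

namespace Literature.NumberTheory.Automorphic.Liu2021.Def45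

open Literature.NumberTheory.Automorphic.IdeleClassGroup

/-! ## §1 Bullet 3 ⇒ bullet 4 on every admissible orbit, at every face of a Galois CM field -/

section Supply

variable {F : Type} [Field F] [NumberField F] [IsCMField F] [Algebra F ℂ]
  {μ : IdeleClassGroup F →ₜ* Circle}

/-- **[Liu2021, Def. 4.5 (2)]: bullet 3 implies the bullet-4 normalisation on every admissible orbit** («the existence
of `r_μ` is obvious», l. 1982 — here a THEOREM for the `H¹`-reading `IsRMuNormalisable`).  `F` a CM field Galois over
`ℚ` with `F ⊆ ℂ`, `μ` conjugate symplectic, `A/F`, `i : M_μ → End⁰(A)`, `θ₂` a class with `IsPolarisationClass (M_μ ⊆ ℂ)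
A i θ₂`.  Given `ρ` (complex conjugation on `M_μ`), an orbit generator `w₀` and a functional `c₀` with (R) and (P):
`B(x, y) := σ⁻¹ c₀ Q_{θ₂}(x · w₀, y · w₀)` is an `F`-bilinear form on `L = F ⊗_ℚ M_μ`, with the engine's adjunction
(bullet 3, clause (c) of `IsPolarisationClass`, through `actL_mul`), alternating (`polarizationPairingOne_self`) and
non-degenerate ((P) + alternation); hcmisog-isog-2's `exists_isUnit_forall₂_eq_trace_muAlgValueField` at
`(H, e) := (L, id)` gives the unit `a` and `β ∈ M_μ` with `B(x a, y a) = Tr_{L/F}(x (1 ⊗ β) ȳ)`; `e := 1`.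
[cite: Liu2021, Def. 4.5 (2) fourth bullet (TeX l. 1957) and proof of Prop. 4.6 (1) (l. 1982)]
[cite: Shimura1998, §6.2 Theorem 4 (3) and its converse] -/
theorem isRMuNormalisable_of_isPolarisationClass [IsGalois ℚ F] (hμ : IdeleClassGroup.IsConjugateSymplectic F μ)
    (A : AbelianVariety F) (i : muAlgValueField F μ →+* A.endAlgebra)
    (θ₂ : bettiCohomology (A.baseChange ℂ).X 2) :
    haveI := hμ.numberField_muAlgValueField
    IsPolarisationClass (muAlgValueField F μ).subtype A i θ₂ →
      IsRMuNormalisable (muAlgValueField F μ).subtype A i θ₂ := by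
  haveI := hμ.numberField_muAlgValueField
  intro hθ ρ hρ w₀ c₀ hR hP
  -- notation
  set Q := polarizationPairingOne (A.baseChange ℂ).X (ofRatClass (ComplexPoints (A.baseChange ℂ).X) 2 θ₂)
    ((A.baseChange ℂ).dim - 1) with hQ_def
  set ρa : muAlgValueField F μ →ₐ[ℚ] muAlgValueField F μ := ρ.toRatAlgHom with hρa_def
  have hρa_apply : ∀ x, ρa x = ρ x := fun x => rfl
  have hρa : ∀ x, ((ρa x : muAlgValueField F μ) : ℂ) = conj (x : ℂ) := fun x => hρ x
  have hinj : Function.Injective (algebraMap F ℂ) := (algebraMap F ℂ).injective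
  -- the `F`-valued Gram function on `L = F ⊗ M_μ` (hypothesis (R))
  choose g hg using hR
  -- … is `F`-bilinear
  have g_add_left : ∀ x₁ x₂ y, g (x₁ + x₂) y = g x₁ y + g x₂ y := fun x₁ x₂ y => hinj (by
    rw [map_add, hg, hg, hg, actL_add, LinearMap.add_apply, map_add, LinearMap.add_apply, map_add])
  have g_smul_left : ∀ (f : F) x y, g (f • x) y = f • g x y := fun f x y => hinj (by
    rw [smul_eq_mul, map_mul, hg, hg, actL_smul, LinearMap.smul_apply, map_smul, LinearMap.smul_apply, map_smul,
      smul_eq_mul])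
  have g_add_right : ∀ x y₁ y₂, g x (y₁ + y₂) = g x y₁ + g x y₂ := fun x y₁ y₂ => hinj (by
    rw [map_add, hg, hg, hg, actL_add, LinearMap.add_apply, map_add, map_add])
  have g_smul_right : ∀ (f : F) x y, g x (f • y) = f • g x y := fun f x y => hinj (by
    rw [smul_eq_mul, map_mul, hg, hg, actL_smul, LinearMap.smul_apply, map_smul, map_smul, smul_eq_mul])
  let B : LinearMap.BilinForm F (F ⊗[ℚ] muAlgValueField F μ) :=
    LinearMap.mk₂ F g g_add_left g_smul_left g_add_right g_smul_right
  have hB : ∀ x y, algebraMap F ℂ (B x y) = c₀ (Q (actL A i x w₀) (actL A i y w₀)) := fun x y => hg x y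
  -- bullet 3 (Rosati, clause (c)) is the engine's adjunction hypothesis
  have hRos : ∀ (m : muAlgValueField F μ) (u v : F ⊗[ℚ] muAlgValueField F μ),
      B (((1 : F) ⊗ₜ[ℚ] m) • u) v = B u (((1 : F) ⊗ₜ[ℚ] ρa m) • v) := by
    intro m u v
    apply hinj
    rw [hB, hB, smul_eq_mul, smul_eq_mul, actL_mul, actL_mul, actL_one_tmul, actL_one_tmul, Module.End.mul_apply,
      Module.End.mul_apply, hρa_apply]
    exact congrArg c₀ (hθ.2.2 m (ρ m) (hρ m) _ _)
  -- alternation of `Q_{θ₂}` on `H¹`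
  have hAlt : B.IsAlt := fun u => hinj (by rw [hB, hQ_def, polarizationPairingOne_self, map_zero, map_zero])
  -- perfectness (P) + alternation ⇒ non-degenerate
  have hNd : B.Nondegenerate := by
    refine ⟨fun x hx => hP x fun y => ?_, fun y hy => hP y fun x => ?_⟩
    · rw [← hB, hx y, map_zero]
    · rw [← hB, ← hAlt.neg_eq x y, hy x, neg_zero, map_zero]
  -- the prescribed `β` and the engine (unit form) at `(H, e) := (L, id)`
  obtain ⟨β, hβ, hβ0⟩ := exists_map_eq_neg_ne_zero_muAlgValueField hμ ρa hρa
  obtain ⟨a, ha, hident⟩ := exists_isUnit_forall₂_eq_trace_muAlgValueField hμ ρa hρa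
    (LinearEquiv.refl (F ⊗[ℚ] muAlgValueField F μ) (F ⊗[ℚ] muAlgValueField F μ)) B hRos hAlt hNd β hβ hβ0
  refine ⟨a, β, 1, ha, one_ne_zero, fun x y => ?_⟩
  rw [← hB, one_mul]
  exact congrArg (algebraMap F ℂ) (hident x y)

end Supply

/-! ## §2 The carrier `RMuForm` is inhabited; Prop. 4.6 (1) over `PolDR σ hμ (RMuForm σ hμ)` from the one cite `h21` -/

section Carrier

variable {F : Type} [Field F] [NumberField F] [IsCMField F] [IsGalois ℚ F] (σ : F →+* ℂ)
  {μ : IdeleClassGroup F →ₜ* Circle} (hμ : IdeleClassGroup.IsConjugateSymplectic F μ)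

/-- **`Def45.RMuForm σ hμ A i` is inhabited for every `(A, i)`** at every face of a Galois CM field: bullet 3 at `θ₂`
implies the bullet-4 normalisation at `θ₂` (`isRMuNormalisable_of_isPolarisationClass`).  With `R := RMuForm σ hμ` the
END displays' `hR : ∀ A i, Nonempty (R A i)` is THIS THEOREM.
[cite: Liu2021, Def. 4.5 (2) fourth bullet (TeX l. 1957) and proof of Prop. 4.6 (1) (l. 1982)] -/
theorem rMuForm_nonempty (A : AbelianVariety F) (i : muAlgValueField F μ →+* A.endAlgebra) :
    Nonempty (RMuForm σ hμ A i) :=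
  letI : Algebra F ℂ := σ.toAlgebra
  ⟨⟨fun θ₂ hθ => isRMuNormalisable_of_isPolarisationClass hμ A i θ₂ hθ⟩⟩

/-- **[Liu2021, Prop. 4.6 (1)] «`𝒜(μ)` is nonempty» over the carrier with ALL FOUR bullets of Def. 4.5 (2) typed real,
from the ONE cite `h21`** ([Shimura1998] Thm. 21.4 = Casselman's theorem, [Shi71] Thm. 6): for a CM field `F` Galois over
`ℚ`, a pin `σ : F → ℂ`, `μ` conjugate symplectic of weight one, there is a CM datum over
`Carriers.ofPolDR μ (PolDR σ hμ (RMuForm σ hμ))` — `Def45PolarisationNormalised.nonempty_cmDatum_polarised_of_casselman'`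
(bullets 1–3, (19.10b) discharged by b25) with its token `R`/`hR` INSTANTIATED by `RMuForm σ hμ` / `rMuForm_nonempty`.
Consumer recipe: `P := Def45.PolDR ι₁ (…) (Def45.RMuForm ι₁ (…))`, `hObj := Def45.nonempty_cmDatum_polDR_rMuForm_of_casselman
ι₁ (…) (…) h21`; no `R`, no `hR`. [cite: Liu2021, Prop. 4.6 (1) (TeX l. 1969) and its proof (ll. 1975–1984)]
[cite: Shimura1998, §21.4 Thm. 21.4] -/
theorem nonempty_cmDatum_polDR_rMuForm_of_casselman (hw : IdeleClassGroup.HasWeight F μ 1)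
    (h21 : shimura1998_thm21_4_casselman) :
    Nonempty (CMDatum (AlgHom.id ℚ F) σ hμ hw (Carriers.ofPolDR μ (PolDR σ hμ (RMuForm σ hμ)))) :=
  nonempty_cmDatum_polarised_of_casselman' σ hμ hw h21 (RMuForm σ hμ) (rMuForm_nonempty σ hμ)

end Carrier

end Literature.NumberTheory.Automorphic.Liu2021.Def45

end
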